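import Summits.QuantumFields.YangMills.Theorems.F4SubCurvatureDoorShortRootRP
import Summits.QuantumFields.YangMills.Theorems.F4SubCurvatureDoorChamberSorting
import Literature.Analysis.Complex.CrossTheoremNStrips
import Mathlib
import HarnessLib

/-!
# Route `F4SubCurvatureDoor`, crux ⟨stmt-QuantumFields-23125⟩ `RationalToGeneral` / parent ⟨23035⟩ `ShortRootRigidity`:
# LINE g17-A «SEXTIC CHANNEL» (planner `ym-idea-3` g17, skeleton `l17/sextic_channel.lean` v3), registered stub A
# `MirrorAnalyticity` — SPELLED OUT and PROVED: a kernel of the C3 class is jointly real-analytic at EVERY `x ≠ 0`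

The g16 theorem `jointAnalyticityOffMirrors` (C1, p681441) gives joint real-analyticity of a `W(B₄)`-invariant reflection-positive
kernel only OFF the four coordinate mirrors; `analyticAt_axis_of_class` (p685223) adds the axes.  With the GLOBAL `D₄`-lattice
invariance of C3 the blind points disappear: the 24 short roots of `F₄` (the `W(F₄)`-images of `e₀`) carry reflection positivity
across each of their 12 mirrors, and they have the SPANNING PROPERTY — for every `x ≠ 0` four linearly independent short roots
are non-orthogonal to `x`.  Here it is used in CHAMBER FORM (no case split): after a sorting signed permutation
(`exists_signedPerm_chamber`: `W(B₄)` moves every `x` into the closed chamber `x₀ ≥ x₁ ≥ x₂ ≥ x₃ ≥ 0`), ONE oblique frame of short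
roots `u = (e₀, ½(1,1,1,1), ½(1,1,1,−1), ½(1,1,−1,1)) = (e₀, H₄e₀, θ₃H₄e₀, θ₂H₄e₀)` serves the whole chamber:
`⟪x, u_j⟫ ≥ x₀/2 > 0` for all four `j`.  Each `u_j = R_j e₀` for a global symmetry `R_j ∈ {1, H₄, θ₃H₄, θ₂H₄}` of `K`, so the slices
`s ↦ K(x + Σ_{i≠j} t_i u_i + s u_j)` continue holomorphically to half-planes (`continuation_of_invariant`, p685223), bounded by the
on-axis values; with the margin `ℓ = x₀/20` all points and axis parameters stay in the compact annulus `{ℓ ≤ ‖y‖ ≤ ‖x‖ + 6ℓ}`, so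
Siciak's cross theorem `exists_holomorphic_extension_of_separately_local_fintype` and the chart lemma
`analyticAt_of_holomorphic_chart_fintype` in the oblique basis (`basisOfLinearIndependentOfCardEqFinrank`) give `AnalyticAt ℝ K x` —
the C1 assembly verbatim with `(e_k) ↦ (u_j)` and only the positive branch.

* (part 1/2 `F4SubCurvatureDoorChamberSorting`: `exists_signedPerm_chamber` — sorting by a signed permutation);
* `analyticAt_of_chamber` — the oblique-frame assembly on the chamber;
* `mirrorAnalyticity` — **stub A spelled out** (binders `hK hbd hB hRP hlat`; the budget `‖x‖⁸K → 0` is NOT used):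
  `∀ x ≠ 0, AnalyticAt ℝ K x`.

Mathlib + tree only; THEOREMS ONLY; no `sorry`; standard axioms.  HONEST FRAMING: a support stub toward the OPEN crux 23125 / 23035
(`--supports stmt-QuantumFields-23125`); the wall C3 (`AnalyticFiniteType` ∧ `FiniteTypeRigidity`) is untouched; no crux, rung of
LADDER-YM (`BalabanLadder.ROT`) or mass-gap statement is proved.  Width seat `ym-line-sfw-p2-w4` g20 (cell ym-idea-1, free hands).
[cite: GlimmJaffeQP1987, §6.1 Thm. 6.1.3] [cite: JarnickiPflug2011, Ch. 5]
-/

set_option autoImplicit false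

noncomputable section

namespace Summit.QuantumFields.YangMills.Theorems.F4SubCurvatureDoorGlobalReduction

open scoped Topology InnerProductSpace
open Filter Set Metric
open Literature.MathematicalPhysics.QuantumLattice (timeReflection timeReflection_apply siteToE)
open Literature.MathematicalPhysics.QuantumFieldTheory (IsMirrorRPKernel)
open Summit.QuantumFields.YangMills.Cruxes.OSLegsAtWeakCouplingC.Sketch (IsSignedPerm)

/-! ## §1 The oblique short-root frame on the chamber, and the chart assembly -/

section Chamber

variable {K : EuclideanSpace ℝ (Fin 4) → ℝ}

/-- **Analyticity on the closed chamber.**  For `K` of the C3 class (continuous off `0`, bounded outside the unit ball,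
`W(B₄)`-invariant, reflection positive, invariant under the `D₄`-lattice isometries) and `x` with `x₀ > 0`,
`x₁ ≥ x₂ ≥ x₃ ≥ 0` (in particular every non-zero point of the closed chamber): `K` is jointly real-analytic at `x`.  The oblique frame `(e₀, H₄e₀, θ₃H₄e₀, θ₂H₄e₀)` of short roots, each making inner
product `≥ x₀/2` with `x`; OS continuation along each (`continuation_of_invariant`); Siciak's cross theorem; the chart lemma.
[cite: GlimmJaffeQP1987, §6.1 Thm. 6.1.3] [cite: JarnickiPflug2011, Ch. 5] -/
theorem analyticAt_of_chamber (hK : ContinuousOn K {x | x ≠ 0}) (hbd : ∃ C : ℝ, ∀ x, 1 ≤ ‖x‖ → |K x| ≤ C)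
    (hB : ∀ R : EuclideanSpace ℝ (Fin 4) ≃ₗᵢ[ℝ] EuclideanSpace ℝ (Fin 4), IsSignedPerm R → ∀ x, K (R x) = K x)
    (hRP : ∀ (m : ℕ) (x : Fin m → EuclideanSpace ℝ (Fin 4)) (c : Fin m → ℝ), (∀ i, 0 < x i 0) →
        0 ≤ ∑ i, ∑ j, c i * c j * K (timeReflection 4 (x i) - x j))
    (hlat : ∀ R : EuclideanSpace ℝ (Fin 4) ≃ₗᵢ[ℝ] EuclideanSpace ℝ (Fin 4),
      (∀ z : Fin 4 → ℤ, Even (∑ i, z i) → ∃ w : Fin 4 → ℤ, Even (∑ i, w i) ∧ R (siteToE z) = siteToE w) →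
      ∀ x, K (R x) = K x)
    {x : EuclideanSpace ℝ (Fin 4)} (h0 : 0 < x 0) (h2 : x 2 ≤ x 1) (h3 : x 3 ≤ x 2) (h4 : 0 ≤ x 3) :
    AnalyticAt ℝ K x := by
  -- the Hadamard frame and the four global symmetries `R_j`
  obtain ⟨H, hHcoord, hHlat, hHe, _⟩ := exists_hadamard_frame
  set e₀ : EuclideanSpace ℝ (Fin 4) := EuclideanSpace.single 0 (1 : ℝ) with he₀
  set θ : Fin 4 → (EuclideanSpace ℝ (Fin 4) ≃ₗᵢ[ℝ] EuclideanSpace ℝ (Fin 4)) :=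
    fun k => (ℝ ∙ (EuclideanSpace.single k (1 : ℝ) : EuclideanSpace ℝ (Fin 4)))ᗮ.reflection with hθ
  set Rf : Fin 4 → (EuclideanSpace ℝ (Fin 4) ≃ₗᵢ[ℝ] EuclideanSpace ℝ (Fin 4)) :=
    ![LinearIsometryEquiv.refl ℝ _, H, H.trans (θ 3), H.trans (θ 2)] with hRf
  have hinv : ∀ (j : Fin 4) (y : EuclideanSpace ℝ (Fin 4)), K (Rf j y) = K y := by
    intro j y
    fin_cases j
    · rfl
    · exact hlat H hHlat y
    · show K (θ 3 (H y)) = K y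
      rw [hθ, mirror_invariant_of_signedPerm hB 3, hlat H hHlat]
    · show K (θ 2 (H y)) = K y
      rw [hθ, mirror_invariant_of_signedPerm hB 2, hlat H hHlat]
  -- the oblique frame `u_j = R_j e₀` and its coordinates
  set u : Fin 4 → EuclideanSpace ℝ (Fin 4) := fun j => Rf j e₀ with hu
  have hnorm_u : ∀ j, ‖u j‖ = 1 := fun j => by
    rw [hu]; dsimp only; rw [LinearIsometryEquiv.norm_map, he₀, norm_single_one]
  have hHe' : ∀ i : Fin 4, H e₀ i = 1 / 2 := fun i => by rw [he₀]; exact hHe i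
  have hu0 : ∀ i : Fin 4, u 0 i = if i = 0 then 1 else 0 := fun i => by
    show (LinearIsometryEquiv.refl ℝ _ e₀) i = _
    rw [LinearIsometryEquiv.coe_refl, id, he₀, PiLp.single_apply]
  have hu1 : ∀ i : Fin 4, u 1 i = 1 / 2 := fun i => by
    show H e₀ i = _; exact hHe' i
  have hu2 : ∀ i : Fin 4, u 2 i = if i = 3 then -(1 / 2) else 1 / 2 := fun i => by
    show (H.trans (θ 3)) e₀ i = _
    rw [LinearIsometryEquiv.trans_apply, hθ, reflection_single_apply, hHe']
  have hu3 : ∀ i : Fin 4, u 3 i = if i = 2 then -(1 / 2) else 1 / 2 := fun i => by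
    show (H.trans (θ 2)) e₀ i = _
    rw [LinearIsometryEquiv.trans_apply, hθ, reflection_single_apply, hHe']
  -- inner products with the frame, and the margin on the chamber
  have hux0 : x 0 / 2 ≤ ⟪x, u 0⟫_ℝ := by
    rw [real_inner_fin_four, hu0, hu0, hu0, hu0]; simp; linarith
  have hux1 : x 0 / 2 ≤ ⟪x, u 1⟫_ℝ := by
    rw [real_inner_fin_four, hu1, hu1, hu1, hu1]; linarith
  have hux2 : x 0 / 2 ≤ ⟪x, u 2⟫_ℝ := by
    rw [real_inner_fin_four, hu2, hu2, hu2, hu2]; simp; linarith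
  have hux3 : x 0 / 2 ≤ ⟪x, u 3⟫_ℝ := by
    rw [real_inner_fin_four, hu3, hu3, hu3, hu3]; simp; linarith
  have hux : ∀ j, x 0 / 2 ≤ ⟪x, u j⟫_ℝ := by
    intro j
    fin_cases j
    · exact hux0
    · exact hux1
    · exact hux2
    · exact hux3
  have hli : LinearIndependent ℝ u := by
    rw [Fintype.linearIndependent_iff]
    intro g hg
    have hc : ∀ i, ∑ j, g j * u j i = 0 := fun i => by rw [← sum_smul_apply, hg]; rfl
    have c0 := hc 0
    have c1 := hc 1
    have c2 := hc 2
    have c3 := hc 3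
    rw [Fin.sum_univ_four, hu0, hu1, hu2, hu3] at c0 c1 c2 c3
    simp at c0 c1 c2 c3
    have g3 : g 3 = 0 := by linarith
    have g2 : g 2 = 0 := by linarith
    have g1 : g 1 = 0 := by linarith
    have g0 : g 0 = 0 := by linarith
    intro j
    fin_cases j
    · exact g0
    · exact g1
    · exact g2
    · exact g3
  set b : Module.Basis (Fin 4) ℝ (EuclideanSpace ℝ (Fin 4)) :=
    basisOfLinearIndependentOfCardEqFinrank hli (by simp) with hb_def
  have hb : ∀ j, b j = u j := fun j => by rw [hb_def, coe_basisOfLinearIndependentOfCardEqFinrank]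
  -- Cauchy–Schwarz against the unit frame vectors
  have habs : ∀ (y : EuclideanSpace ℝ (Fin 4)) (j : Fin 4), |⟪y, u j⟫_ℝ| ≤ ‖y‖ := fun y j => by
    have := abs_real_inner_le_norm y (u j); rwa [hnorm_u, mul_one] at this
  have huu : ∀ i j : Fin 4, |⟪u i, u j⟫_ℝ| ≤ 1 := fun i j => by
    have := habs (u i) j; rwa [hnorm_u] at this
  -- the margin
  set ℓ : ℝ := x 0 / 20 with hℓ_def
  have hℓ : 0 < ℓ := by positivity
  have hxu : ∀ j, 10 * ℓ ≤ ⟪x, u j⟫_ℝ := fun j => by rw [hℓ_def]; linarith [hux j]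
  -- a compact annulus carrying all the points that occur, and the bound `M` of `K` on it
  set A : Set (EuclideanSpace ℝ (Fin 4)) := {y | ℓ ≤ ‖y‖} ∩ Metric.closedBall 0 (‖x‖ + 6 * ℓ) with hA
  have hAc : IsCompact A :=
    (isCompact_closedBall (0 : EuclideanSpace ℝ (Fin 4)) _).of_isClosed_subset
      ((isClosed_le continuous_const continuous_norm).inter Metric.isClosed_closedBall) Set.inter_subset_right
  have hA0 : A ⊆ {y | y ≠ 0} := by
    intro y hy hy0
    have h1' : ℓ ≤ ‖y‖ := hy.1
    rw [hy0, norm_zero] at h1'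
    linarith
  obtain ⟨M₀, hM₀⟩ := hAc.exists_bound_of_continuousOn (hK.mono hA0)
  set M : ℝ := max M₀ 0 with hM
  have hMA : ∀ y : EuclideanSpace ℝ (Fin 4), ℓ ≤ ‖y‖ → ‖y‖ ≤ ‖x‖ + 6 * ℓ → |K y| ≤ M := by
    intro y hy1 hy2
    have := hM₀ y ⟨hy1, by rwa [Metric.mem_closedBall, dist_zero_right]⟩
    rw [Real.norm_eq_abs] at this
    exact this.trans (le_max_left _ _)
  -- axis points `τ u_j`, `τ ∈ [ℓ, ‖x‖ + 6ℓ]`, lie in the annulus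
  have haxis : ∀ (j : Fin 4) (τ : ℝ), ℓ ≤ τ → τ ≤ ‖x‖ + 6 * ℓ → |K (τ • u j)| ≤ M := by
    intro j τ hτ1 hτ2
    have hn : ‖τ • u j‖ = τ := by
      rw [norm_smul, hnorm_u, mul_one, Real.norm_of_nonneg (by linarith)]
    exact hMA _ (by rw [hn]; exact hτ1) (by rw [hn]; exact hτ2)
  -- sums against the frame are small on the cube of side `ℓ`
  have hsum_inner : ∀ (t : Fin 4 → ℝ) (k : Fin 4), (∀ j, |t j| < ℓ) → |⟪∑ j, t j • u j, u k⟫_ℝ| ≤ 4 * ℓ := by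
    intro t k ht
    rw [sum_inner]
    refine (Finset.abs_sum_le_sum_abs _ _).trans ?_
    have : ∀ j ∈ (Finset.univ : Finset (Fin 4)), |⟪t j • u j, u k⟫_ℝ| ≤ ℓ := by
      intro j _
      rw [real_inner_smul_left, abs_mul]
      calc |t j| * |⟪u j, u k⟫_ℝ| ≤ ℓ * 1 :=
            mul_le_mul (ht j).le (huu j k) (abs_nonneg _) hℓ.le
        _ = ℓ := mul_one ℓ
    refine (Finset.sum_le_sum this).trans ?_
    simp
  have hsum_norm : ∀ t : Fin 4 → ℝ, (∀ j, |t j| < ℓ) → ‖∑ j, t j • u j‖ ≤ 4 * ℓ := by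
    intro t ht
    refine (norm_sum_le _ _).trans ?_
    have : ∀ j ∈ (Finset.univ : Finset (Fin 4)), ‖t j • u j‖ ≤ ℓ := by
      intro j _
      rw [norm_smul, hnorm_u, mul_one, Real.norm_eq_abs]
      exact (ht j).le
    refine (Finset.sum_le_sum this).trans ?_
    simp
  -- the radius of the cross theorem
  obtain ⟨r, hr, hcross⟩ :=
    Literature.Analysis.Complex.exists_holomorphic_extension_of_separately_local_fintype (ι := Fin 4) ℓ hℓ
  -- the restriction of `K` to the oblique chart at `x`
  set P : (Fin 4 → ℝ) → ℂ := fun t => ((K (x + ∑ k, t k • u k) : ℝ) : ℂ) with hP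
  have hnorm : ∀ t : Fin 4 → ℝ, (∀ k, |t k| < ℓ) →
      ℓ ≤ ‖x + ∑ k, t k • u k‖ ∧ ‖x + ∑ k, t k • u k‖ ≤ ‖x‖ + 6 * ℓ := by
    intro t ht
    constructor
    · have h1' : ⟪x + ∑ k, t k • u k, u 0⟫_ℝ ≤ ‖x + ∑ k, t k • u k‖ :=
        (le_abs_self _).trans (habs _ 0)
      rw [inner_add_left] at h1'
      have h2' := (abs_le.1 (hsum_inner t 0 ht)).1
      linarith [hxu 0]
    · have := norm_add_le x (∑ k, t k • u k)
      linarith [hsum_norm t ht]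
  have hPbound : ∀ t : Fin 4 → ℝ, (∀ k, |t k| < ℓ) → ‖P t‖ ≤ M := by
    intro t ht
    rw [hP]
    dsimp only
    rw [Complex.norm_real, Real.norm_eq_abs]
    exact hMA _ (hnorm t ht).1 (hnorm t ht).2
  -- the slices are traces of bounded holomorphic functions on `ball 0 ℓ`
  have hslice : ∀ (k : Fin 4) (y : Fin 4 → ℝ), (∀ j, |y j| < ℓ) → ∃ g : ℂ → ℂ,
      DifferentiableOn ℂ g (Metric.ball (0 : ℂ) ℓ) ∧ (∀ w ∈ Metric.ball (0 : ℂ) ℓ, ‖g w‖ ≤ M) ∧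
      ∀ t : ℝ, |t| < ℓ → g t = P (Function.update y k t) := by
    intro k y hy
    -- the axis parameter `c₀` and the transverse part `v ⊥ u_k` of the slice
    set c₀ : ℝ := ⟪x + ∑ j, y j • u j, u k⟫_ℝ - y k with hc₀
    set v : EuclideanSpace ℝ (Fin 4) := x + ∑ j, y j • u j - (y k + c₀) • u k with hv
    have huk : ⟪u k, u k⟫_ℝ = 1 := by rw [real_inner_self_eq_norm_sq, hnorm_u, one_pow]
    have hvk : ⟪v, Rf k e₀⟫_ℝ = 0 := by
      show ⟪v, u k⟫_ℝ = 0
      rw [hv, inner_sub_left, real_inner_smul_left, huk, hc₀]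
      ring
    have hc₀l : 5 * ℓ ≤ c₀ := by
      have h2' := (abs_le.1 (hsum_inner y k hy)).1
      have h3' := (abs_lt.1 (hy k)).2
      rw [hc₀, inner_add_left]
      linarith [hxu k]
    have hc₀u : c₀ ≤ ‖x‖ + 5 * ℓ := by
      have h1' := (abs_le.1 (habs x k)).2
      have h2' := (abs_le.1 (hsum_inner y k hy)).2
      have h3' := (abs_lt.1 (hy k)).1
      rw [hc₀, inner_add_left]
      linarith
    have hslicept : ∀ t : ℝ, x + ∑ j, (Function.update y k t) j • u j = (c₀ + t) • Rf k e₀ + v := by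
      intro t
      show x + ∑ j, (Function.update y k t) j • u j = (c₀ + t) • u k + v
      have hupd : ∑ j, (Function.update y k t) j • u j = ∑ j, y j • u j + (t - y k) • u k := by
        have : ∀ j, (Function.update y k t) j • u j = y j • u j + (if j = k then (t - y k) • u k else 0) := by
          intro j
          by_cases hj : j = k
          · subst hj
            rw [Function.update_self, if_pos rfl, ← add_smul]
            ring_nf
          · rw [Function.update_of_ne hj, if_neg hj, add_zero]
        rw [Finset.sum_congr rfl fun j _ => this j, Finset.sum_add_distrib, Finset.sum_ite_eq' Finset.univ k,
          if_pos (Finset.mem_univ k)]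
      rw [hupd, hv]
      module
    have hreal : ∀ t : ℝ, P (Function.update y k t) = ((K ((c₀ + t) • Rf k e₀ + v) : ℝ) : ℂ) := by
      intro t; rw [hP]; dsimp only; rw [hslicept]
    -- the half-plane continuation along `u_k`
    obtain ⟨F, hFd, hFr, hFb⟩ := continuation_of_invariant hK hbd hB hRP (Rf k) (hinv k) hvk
    have hre : ∀ s : ℂ, ‖s‖ < ℓ → |s.re| < ℓ := fun s hs => (Complex.abs_re_le_norm s).trans_lt hs
    refine ⟨fun s => F (((c₀ : ℝ) : ℂ) + s), ?_, ?_, ?_⟩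
    · refine hFd.comp ((differentiableOn_const _).add differentiableOn_id) fun s hs => ?_
      rw [Metric.mem_ball, dist_zero_right] at hs
      show 0 < (((c₀ : ℝ) : ℂ) + s).re
      rw [Complex.add_re, Complex.ofReal_re]
      linarith [abs_lt.1 (hre s hs)]
    · intro s hs
      rw [Metric.mem_ball, dist_zero_right] at hs
      have hs' := abs_lt.1 (hre s hs)
      have hsre : 0 < (((c₀ : ℝ) : ℂ) + s).re := by
        rw [Complex.add_re, Complex.ofReal_re]
        linarith
      refine (hFb _ hsre).trans ((le_abs_self _).trans (haxis k _ ?_ ?_))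
      · rw [Complex.add_re, Complex.ofReal_re]; linarith
      · rw [Complex.add_re, Complex.ofReal_re]; linarith
    · intro t ht
      have hpos' : 0 < c₀ + t := by linarith [abs_lt.1 ht]
      have h1' : (((c₀ : ℝ) : ℂ) + (t : ℂ)) = (((c₀ + t : ℝ)) : ℂ) := by push_cast; ring
      show F (((c₀ : ℝ) : ℂ) + (t : ℂ)) = P (Function.update y k t)
      rw [h1', hFr _ hpos', hreal]
  -- the cross theorem and the chart lemma
  obtain ⟨G, hGd, _, hGr⟩ := hcross M P hPbound hslice
  refine Literature.Analysis.Complex.analyticAt_of_holomorphic_chart_fintype b hr hGd fun t ht => ?_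
  rw [hGr t ht, hP]
  simp only [hb]

end Chamber

/-! ## §2 Stub A `MirrorAnalyticity`, spelled out -/

/-- **Registered stub A `MirrorAnalyticity` of LINE g17-A (skeleton `l17/sextic_channel.lean` v3 on ⟨23125⟩), SPELLED OUT**:
a kernel `K : ℝ⁴ → ℝ` continuous off `0`, bounded outside the unit ball, `W(B₄)`-invariant, reflection positive across `x₀ = 0`
and invariant under every isometry preserving the checkerboard lattice `D₄` is jointly real-analytic at EVERY `x ≠ 0` — on the
coordinate mirrors too.  (The sub-curvature budget of the class is not used.)  Sorting signed permutation + `analyticAt_of_chamber`.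
[cite: GlimmJaffeQP1987, §6.1 Thm. 6.1.3] [cite: JarnickiPflug2011, Ch. 5] -/
theorem mirrorAnalyticity (K : EuclideanSpace ℝ (Fin 4) → ℝ)
    (hK : ContinuousOn K {x | x ≠ 0}) (hbd : ∃ C : ℝ, ∀ x, 1 ≤ ‖x‖ → |K x| ≤ C)
    (hB : ∀ R : EuclideanSpace ℝ (Fin 4) ≃ₗᵢ[ℝ] EuclideanSpace ℝ (Fin 4), IsSignedPerm R → ∀ x, K (R x) = K x)
    (hRP : ∀ (m : ℕ) (x : Fin m → EuclideanSpace ℝ (Fin 4)) (c : Fin m → ℝ), (∀ i, 0 < x i 0) →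
        0 ≤ ∑ i, ∑ j, c i * c j * K (timeReflection 4 (x i) - x j))
    (hlat : ∀ R : EuclideanSpace ℝ (Fin 4) ≃ₗᵢ[ℝ] EuclideanSpace ℝ (Fin 4),
      (∀ z : Fin 4 → ℤ, Even (∑ i, z i) → ∃ w : Fin 4 → ℤ, Even (∑ i, w i) ∧ R (siteToE z) = siteToE w) →
      ∀ x, K (R x) = K x) :
    ∀ x : EuclideanSpace ℝ (Fin 4), x ≠ 0 → AnalyticAt ℝ K x := by
  intro x hx
  obtain ⟨R, hR, h3, h32, h21, h10⟩ := exists_signedPerm_chamber x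
  -- the sorted point is non-zero, so its top coordinate is positive
  have h0 : 0 < R x 0 := by
    by_contra hle
    rw [not_lt] at hle
    apply hx
    have e0 : R x 0 = 0 := by linarith
    have e1 : R x 1 = 0 := by linarith
    have e2 : R x 2 = 0 := by linarith
    have e3 : R x 3 = 0 := by linarith
    have hzero : ∀ i, R x i = 0 := by
      intro i
      fin_cases i
      · exact e0
      · exact e1
      · exact e2
      · exact e3
    have hRx : R x = 0 := by
      ext i; rw [hzero]; rfl
    exact R.injective (by rw [hRx, map_zero])
  have hA : AnalyticAt ℝ K (R x) := analyticAt_of_chamber hK hbd hB hRP hlat h0 h21 h32 h3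
  have hlin : AnalyticAt ℝ (fun y => R y) x :=
    (R.toContinuousLinearEquiv : EuclideanSpace ℝ (Fin 4) →L[ℝ] EuclideanSpace ℝ (Fin 4)).analyticAt x
  have hcomp : AnalyticAt ℝ (fun y => K (R y)) x := hA.comp hlin
  have hfun : (fun y => K (R y)) = K := funext (hB R hR)
  rwa [hfun] at hcomp

end Summit.QuantumFields.YangMills.Theorems.F4SubCurvatureDoorGlobalReduction

end
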